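import Mathlib.MeasureTheory.Integral.IntervalIntegral.FundThmCalculus
import Mathlib.Analysis.SpecialFunctions.ExpDeriv
import Mathlib.Analysis.SpecialFunctions.Log.Basic
import Mathlib.Data.Int.Interval
import HarnessLib

/-!
# Sums over the nodes of a counting function against `∫ F dG` — Abel/Euler summation with a variable density

Topic `Literature/Analysis/Quadrature`, companion of `LatticeWindowRiemannSum.lean` (equispaced nodes `t₀ + kΔ`). Here the
nodes are the points of a window `[T₁, T₂]` at which a continuous, strictly increasing COUNTING FUNCTION `G` takes integer
values (so there is one node per unit of `G`, and `G′ = g ≥ 0` is the node density): for `F : ℝ → E` (any complete real normed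
space) continuous on the window with an integrable right derivative on its interior and `‖F‖ ≤ M₀`,

  `‖Σ_{k ∈ ℤ ∩ [G(T₁), G(T₂)]} F(G⁻¹ k) − ∫_{T₁}^{T₂} g(t) • F(t) dt‖ ≤ 3M₀ + ∫_{T₁}^{T₂} ‖F′‖`

(`norm_sum_countingNodes_sub_integral_smul_le`; `G⁻¹ k` is `Function.invFunOn G [T₁, T₂] k`, characterised by
`countingNode_mem_Icc` / `apply_countingNode`; a user holding an explicit enumeration `t_k` with `G(t_k) = k` rewrites with
`countingNode_eq_of_apply_eq`). This is the inequality one reads off ABEL'S IDENTITY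
`Σ_{y<n≤x} a(n)f(n) = A(x)f(x) − A(y)f(y) − ∫_y^x A(t)f′(t) dt` [Apostol1976, Thm 4.2] with `A` the counting function of the
nodes (`|A − G| ≤ 1`) followed by an integration by parts of `∫ G f′` — for `G(t) = t` it is Euler's summation formula
[Apostol1976, Thm 3.1]; the proof below is the cell-by-cell telescoping (a cell between consecutive nodes carries `G`-mass
exactly `1` and costs `∫_{cell} ‖F′‖`; the last node and the two ragged ends cost `M₀` each), so the error is in
total-variation form and no inverse-function calculus is needed.

**The mollifier-length corollary** (`norm_sum_inv_smul_logProfile_sub_le`). With `G(u) = y^u` on `[0, 1]` (nodes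
`u = log n / log y`, `1 ≤ n ≤ y`, density `log y · y^u`) and `F(u) = y^{−u} • f(u)`:

  `‖Σ_{1 ≤ n ≤ y} n⁻¹ • f(log n / log y) − log y • ∫₀¹ f‖ ≤ 4·sup‖f‖ + ∫₀¹ ‖f′‖`   (`y > 1`),

for every `f` continuous on `[0, 1]` with an integrable right derivative on `(0, 1)` — the `H¹`-profile form of the
standard «`Σ_{n ≤ y} n⁻¹ P(log n/log y) = (log y)∫₀¹ P + O(1)`» of mollifier calculations, with an explicit and
profile-uniform constant.

**Also here.** The weighted one-cell estimate (`norm_integral_smul_sub_integral_smul_cell_le`); the limit forms of the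
corollary — `(log y)⁻¹ • Σ_{n ≤ y} n⁻¹ • f(log n/log y) → ∫₀¹ f` for a fixed profile (`tendsto_inv_log_smul_sum_inv_smul_logProfile`)
and `(log y_n)⁻¹ • Σ − ∫₀¹ f_n → 0` for stage-dependent profiles with uniform sup/variation bounds
(`tendsto_inv_log_smul_sum_inv_smul_logProfile_sub`); the TWO-SCALE form with length `x` and scale `L`
(`norm_sum_inv_smul_logScale_sub_le`: `‖Σ_{n ≤ x} n⁻¹ • f(log n/L) − L • ∫₀^{log x/L} f‖ ≤ 4M + ∫‖f′‖`, pieces of length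
`y^θ` in the scale `log y`); the equispaced specialisation is
`LatticeWindowRiemannSum.norm_sum_latticeWindow_sub_inv_smul_integral_le` (not re-derived).
**Not here.** Second-order (trapezoidal) corrections; discrepancy/Koksma bounds for arbitrary point sets.

Cell use (not literature): programme F-S3 (landau-siegel) §E row E-102, plan `B-det/plan/E102-DISCHARGE.md` v1.4 §2 piece A0
(Riemann-sum layer), second half: sums over non-equispaced fences (Riemann–von Mangoldt-exact ordinates via their counting
function) and over Dirichlet-polynomial lengths `n ≤ y` in the scale `u = log n/log y`. Nothing in this file refers to that
model.

## References

* T. M. Apostol, *Introduction to Analytic Number Theory*, UTM, Springer (1976), §4.3 Theorem 4.2 (Abel's identity) with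
  the Riemann–Stieltjes remark and the deduction of Euler's summation formula, pp. 76–77; §3.3 Theorem 3.1, p. 54
  [Apostol1976] — read on the page [corpus: book:apostol1976-introduction-analytic-number-theory p0058–p0059, p0046].
-/

noncomputable section

open _root_.MeasureTheory _root_.Set Finset Filter intervalIntegral
open scoped _root_.Topology

namespace Literature.Analysis.Quadrature

variable {E : Type*} [NormedAddCommGroup E] [NormedSpace ℝ E] [CompleteSpace E]

/-! ### The nodes of a counting function -/

/-- **The `k`-th node of the counting function `G` on the window `[T₁, T₂]`**: the point of the window where `G = k`
(`Function.invFunOn`; meaningful for `k ∈ [G T₁, G T₂]` when `G` is continuous and strictly increasing there —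
`countingNode_mem_Icc`, `apply_countingNode`). For `G = A` a step counting function this is Apostol's `n`.
[cite: Apostol1976, Thm 4.2 pp. 76–77] -/
def countingNode (G : ℝ → ℝ) (T₁ T₂ : ℝ) (k : ℤ) : ℝ :=
  Function.invFunOn G (Set.Icc T₁ T₂) k

section Nodes

variable {G : ℝ → ℝ} {T₁ T₂ : ℝ}

/-- A level `k ∈ [G T₁, G T₂]` is attained on the window (intermediate value theorem). [cite: Apostol1976, Thm 4.2 pp. 76–77] -/
theorem exists_apply_eq_of_mem_Icc (hT : T₁ ≤ T₂) (hGc : ContinuousOn G (Set.Icc T₁ T₂)) {k : ℤ}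
    (hk : (k : ℝ) ∈ Set.Icc (G T₁) (G T₂)) : ∃ t ∈ Set.Icc T₁ T₂, G t = k :=
  intermediate_value_Icc hT hGc hk

/-- The node of an attained level lies in the window. [cite: Apostol1976, Thm 4.2 pp. 76–77] -/
theorem countingNode_mem_Icc (hT : T₁ ≤ T₂) (hGc : ContinuousOn G (Set.Icc T₁ T₂)) {k : ℤ}
    (hk : (k : ℝ) ∈ Set.Icc (G T₁) (G T₂)) : countingNode G T₁ T₂ k ∈ Set.Icc T₁ T₂ :=
  Function.invFunOn_mem (exists_apply_eq_of_mem_Icc hT hGc hk)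

/-- `G` takes the value `k` at the `k`-th node. [cite: Apostol1976, Thm 4.2 pp. 76–77] -/
theorem apply_countingNode (hT : T₁ ≤ T₂) (hGc : ContinuousOn G (Set.Icc T₁ T₂)) {k : ℤ}
    (hk : (k : ℝ) ∈ Set.Icc (G T₁) (G T₂)) : G (countingNode G T₁ T₂ k) = k :=
  Function.invFunOn_eq (exists_apply_eq_of_mem_Icc hT hGc hk)

/-- **Explicit enumerations**: if `G` is injective on the window and `G t = k` for some `t` in the window, then the `k`-th
node IS `t` (so a user holding `t_k` with `G (t_k) = k` — lattice points, Riemann–von Mangoldt-exact ordinates,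
`log n / log y` — rewrites the node sum into his own). [cite: Apostol1976, Thm 4.2 pp. 76–77] -/
theorem countingNode_eq_of_apply_eq (hGi : Set.InjOn G (Set.Icc T₁ T₂)) {k : ℤ} {t : ℝ} (ht : t ∈ Set.Icc T₁ T₂)
    (hGt : G t = k) : countingNode G T₁ T₂ k = t :=
  hGi (Function.invFunOn_mem ⟨t, ht, hGt⟩) ht ((Function.invFunOn_eq ⟨t, ht, hGt⟩).trans hGt.symm)

/-- Nodes are strictly ordered by their level (`G` strictly increasing). [cite: Apostol1976, Thm 4.2 pp. 76–77] -/
theorem countingNode_lt_countingNode (hT : T₁ ≤ T₂) (hGc : ContinuousOn G (Set.Icc T₁ T₂))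
    (hGm : StrictMonoOn G (Set.Icc T₁ T₂)) {k l : ℤ} (hk : (k : ℝ) ∈ Set.Icc (G T₁) (G T₂))
    (hl : (l : ℝ) ∈ Set.Icc (G T₁) (G T₂)) (hkl : k < l) :
    countingNode G T₁ T₂ k < countingNode G T₁ T₂ l := by
  rw [← hGm.lt_iff_lt (countingNode_mem_Icc hT hGc hk) (countingNode_mem_Icc hT hGc hl),
    apply_countingNode hT hGc hk, apply_countingNode hT hGc hl]
  exact_mod_cast hkl

end Nodes

/-! ### One weighted cell -/

/-- **One cell with a density.** For `T₁ ≤ u ≤ v ≤ T₂`, `g ≥ 0` integrable on the window and `F` as in the main theorem: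
`‖(∫_u^v g) • F(u) − ∫_u^v g • F‖ ≤ (∫_u^v g)·∫_u^v ‖F′‖` (the oscillation of `F` on the cell is `≤ ∫_{cell} ‖F′‖`).
[cite: Apostol1976, Thm 4.2 pp. 76–77 (proof, one cell)] -/
theorem norm_integral_smul_sub_integral_smul_cell_le {F F' : ℝ → E} {g : ℝ → ℝ} {T₁ T₂ u v : ℝ} (h1 : T₁ ≤ u)
    (huv : u ≤ v) (h2 : v ≤ T₂) (hgi : IntervalIntegrable g volume T₁ T₂) (hg0 : ∀ t ∈ Set.Icc T₁ T₂, 0 ≤ g t)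
    (hF : ContinuousOn F (Set.Icc T₁ T₂)) (hF' : ∀ t ∈ Set.Ioo T₁ T₂, HasDerivWithinAt F (F' t) (Set.Ioi t) t)
    (hint : IntervalIntegrable F' volume T₁ T₂) :
    ‖(∫ t in u..v, g t) • F u - ∫ t in u..v, g t • F t‖ ≤ (∫ t in u..v, g t) * ∫ t in u..v, ‖F' t‖ := by
  have hT : T₁ ≤ T₂ := h1.trans (huv.trans h2)
  have huI : u ∈ Set.Icc T₁ T₂ := ⟨h1, huv.trans h2⟩
  have hvI : v ∈ Set.Icc T₁ T₂ := ⟨h1.trans huv, h2⟩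
  have hsub : Set.uIcc u v ⊆ Set.Icc T₁ T₂ := Set.uIcc_subset_Icc huI hvI
  have hsub' : Set.uIcc u v ⊆ Set.uIcc T₁ T₂ := by rw [Set.uIcc_of_le hT]; exact hsub
  have hgi' : IntervalIntegrable g volume u v := hgi.mono_set hsub'
  have hint' : IntervalIntegrable F' volume u v := hint.mono_set hsub'
  have hnint : IntervalIntegrable (fun t => ‖F' t‖) volume u v := hint'.norm
  have hFc : ContinuousOn F (Set.uIcc u v) := hF.mono hsub
  -- oscillation on the cell
  have hosc : ∀ t ∈ Set.Icc u v, ‖F u - F t‖ ≤ ∫ s in u..v, ‖F' s‖ := by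
    intro t ht
    have htI : t ∈ Set.Icc T₁ T₂ := ⟨h1.trans ht.1, ht.2.trans h2⟩
    have hint'' : IntervalIntegrable F' volume u t :=
      hint.mono_set (by rw [Set.uIcc_of_le hT]; exact Set.uIcc_subset_Icc huI htI)
    have hftc : ∫ s in u..t, F' s = F t - F u :=
      integral_eq_sub_of_hasDeriv_right_of_le ht.1 (hF.mono (Set.Icc_subset_Icc h1 (ht.2.trans h2)))
        (fun s hs => hF' s ⟨lt_of_le_of_lt h1 hs.1, lt_of_lt_of_le hs.2 (ht.2.trans h2)⟩) hint''
    calc ‖F u - F t‖ = ‖∫ s in u..t, F' s‖ := by rw [hftc, norm_sub_rev]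
      _ ≤ ∫ s in u..t, ‖F' s‖ := norm_integral_le_integral_norm ht.1
      _ ≤ ∫ s in u..v, ‖F' s‖ :=
          integral_mono_interval le_rfl ht.1 ht.2 (Eventually.of_forall fun _ => norm_nonneg _) hnint
  set C : ℝ := ∫ s in u..v, ‖F' s‖ with hC
  have hsmul : (∫ t in u..v, g t) • F u = ∫ t in u..v, g t • F u := by
    rw [intervalIntegral.integral_smul_const]
  have hi1 : IntervalIntegrable (fun t => g t • F u) volume u v := hgi'.smul_continuousOn continuousOn_const
  have hi2 : IntervalIntegrable (fun t => g t • F t) volume u v := hgi'.smul_continuousOn hFc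
  rw [hsmul, ← intervalIntegral.integral_sub hi1 hi2]
  have hpt : ∀ t ∈ Set.Icc u v, ‖g t • F u - g t • F t‖ ≤ g t * C := by
    intro t ht
    rw [← smul_sub, norm_smul, Real.norm_of_nonneg (hg0 t ⟨h1.trans ht.1, ht.2.trans h2⟩)]
    exact mul_le_mul_of_nonneg_left (hosc t ht) (hg0 t ⟨h1.trans ht.1, ht.2.trans h2⟩)
  calc ‖∫ t in u..v, g t • F u - g t • F t‖ ≤ ∫ t in u..v, ‖g t • F u - g t • F t‖ :=
        norm_integral_le_integral_norm huv
    _ ≤ ∫ t in u..v, g t * C := intervalIntegral.integral_mono_on huv ((hi1.sub hi2).norm) (hgi'.mul_const C) hpt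
    _ = (∫ t in u..v, g t) * C := intervalIntegral.integral_mul_const C _

/-! ### The main inequality -/

/-- **Sums over the nodes of a counting function against `∫ g • F` — Abel's identity as an inequality with a variable
density.** Let `T₁ ≤ T₂`; `G` continuous and strictly increasing on `[T₁, T₂]` with a right derivative `g t ≥ 0` at every
interior point, `g` integrable on the window; `F : ℝ → E` continuous on `[T₁, T₂]` with a right derivative `F′` at every
interior point, `F′` integrable, `‖F‖ ≤ M₀`. Then, summing `F` over the nodes `G⁻¹(k)`, `k ∈ ℤ ∩ [G T₁, G T₂]`,
`‖Σ_k F(G⁻¹ k) − ∫_{T₁}^{T₂} g(t) • F(t) dt‖ ≤ 3M₀ + ∫_{T₁}^{T₂} ‖F′‖`. (Apostol: `A` = the node-counting step function,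
`|A − G| ≤ 1`; `G(t) = t` is Thm 3.1.) [cite: Apostol1976, Thm 4.2 pp. 76–77] -/
theorem norm_sum_countingNodes_sub_integral_smul_le {F F' : ℝ → E} {G g : ℝ → ℝ} {T₁ T₂ M₀ : ℝ} (hT : T₁ ≤ T₂)
    (hGc : ContinuousOn G (Set.Icc T₁ T₂)) (hGm : StrictMonoOn G (Set.Icc T₁ T₂))
    (hG' : ∀ t ∈ Set.Ioo T₁ T₂, HasDerivWithinAt G (g t) (Set.Ioi t) t)
    (hgi : IntervalIntegrable g volume T₁ T₂) (hg0 : ∀ t ∈ Set.Icc T₁ T₂, 0 ≤ g t)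
    (hF : ContinuousOn F (Set.Icc T₁ T₂)) (hF' : ∀ t ∈ Set.Ioo T₁ T₂, HasDerivWithinAt F (F' t) (Set.Ioi t) t)
    (hint : IntervalIntegrable F' volume T₁ T₂) (hM : ∀ t ∈ Set.Icc T₁ T₂, ‖F t‖ ≤ M₀) :
    ‖∑ k ∈ Finset.Icc ⌈G T₁⌉ ⌊G T₂⌋, F (countingNode G T₁ T₂ k) - ∫ t in T₁..T₂, g t • F t‖
      ≤ 3 * M₀ + ∫ t in T₁..T₂, ‖F' t‖ := by
  have hM0 : 0 ≤ M₀ := (norm_nonneg _).trans (hM T₁ ⟨le_rfl, hT⟩)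
  have hI0 : 0 ≤ ∫ t in T₁..T₂, ‖F' t‖ := intervalIntegral.integral_nonneg hT fun _ _ => norm_nonneg _
  have hT₁I : T₁ ∈ Set.Icc T₁ T₂ := ⟨le_rfl, hT⟩
  have hT₂I : T₂ ∈ Set.Icc T₁ T₂ := ⟨hT, le_rfl⟩
  have hsubu : ∀ {u v}, u ∈ Set.Icc T₁ T₂ → v ∈ Set.Icc T₁ T₂ → Set.uIcc u v ⊆ Set.uIcc T₁ T₂ :=
    fun hu hv => by rw [Set.uIcc_of_le hT]; exact Set.uIcc_subset_Icc hu hv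
  -- FTC for `G`: `∫_u^v g = G v − G u` on sub-intervals of the window
  have hGftc : ∀ u v, T₁ ≤ u → u ≤ v → v ≤ T₂ → ∫ t in u..v, g t = G v - G u := by
    intro u v hu huv hv
    exact integral_eq_sub_of_hasDeriv_right_of_le huv (hGc.mono (Set.Icc_subset_Icc hu hv))
      (fun t ht => hG' t ⟨lt_of_le_of_lt hu ht.1, lt_of_lt_of_le ht.2 hv⟩)
      (hgi.mono_set (hsubu ⟨hu, huv.trans hv⟩ ⟨hu.trans huv, hv⟩))
  -- sub-interval integrability
  have hgF : ∀ u v, u ∈ Set.Icc T₁ T₂ → v ∈ Set.Icc T₁ T₂ →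
      IntervalIntegrable (fun t => g t • F t) volume u v :=
    fun u v hu hv => (hgi.mono_set (hsubu hu hv)).smul_continuousOn (hF.mono (Set.uIcc_subset_Icc hu hv))
  have hnint : IntervalIntegrable (fun t => ‖F' t‖) volume T₁ T₂ := hint.norm
  have hnint' : ∀ u v, u ∈ Set.Icc T₁ T₂ → v ∈ Set.Icc T₁ T₂ →
      IntervalIntegrable (fun t => ‖F' t‖) volume u v :=
    fun u v hu hv => hnint.mono_set (hsubu hu hv)
  -- a weighted integral over `[u, v] ⊆` window has norm `≤ M₀ (G v − G u)`
  have hbd : ∀ u v, T₁ ≤ u → u ≤ v → v ≤ T₂ → ‖∫ t in u..v, g t • F t‖ ≤ M₀ * (G v - G u) := by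
    intro u v hu huv hv
    have huI : u ∈ Set.Icc T₁ T₂ := ⟨hu, huv.trans hv⟩
    have hvI : v ∈ Set.Icc T₁ T₂ := ⟨hu.trans huv, hv⟩
    have hgi' : IntervalIntegrable g volume u v := hgi.mono_set (hsubu huI hvI)
    have hpt : ∀ t ∈ Set.Icc u v, ‖g t • F t‖ ≤ g t * M₀ := by
      intro t ht
      have htI : t ∈ Set.Icc T₁ T₂ := ⟨hu.trans ht.1, ht.2.trans hv⟩
      rw [norm_smul, Real.norm_of_nonneg (hg0 t htI)]
      exact mul_le_mul_of_nonneg_left (hM t htI) (hg0 t htI)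
    calc ‖∫ t in u..v, g t • F t‖ ≤ ∫ t in u..v, ‖g t • F t‖ := norm_integral_le_integral_norm huv
      _ ≤ ∫ t in u..v, g t * M₀ :=
          intervalIntegral.integral_mono_on huv (hgF u v huI hvI).norm (hgi'.mul_const M₀) hpt
      _ = M₀ * (G v - G u) := by rw [intervalIntegral.integral_mul_const, hGftc u v hu huv hv, mul_comm]
  -- the levels
  have hGT : G T₁ ≤ G T₂ := hGm.monotoneOn hT₁I hT₂I hT
  set a : ℤ := ⌈G T₁⌉ with ha
  set b : ℤ := ⌊G T₂⌋ with hb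
  have ha₁ : G T₁ ≤ a := Int.le_ceil _
  have ha₂ : (a : ℝ) < G T₁ + 1 := Int.ceil_lt_add_one _
  have hb₁ : (b : ℝ) ≤ G T₂ := Int.floor_le _
  have hb₂ : G T₂ < b + 1 := Int.lt_floor_add_one _
  rcases lt_or_ge b a with hba | hab
  · -- no node: the window carries `G`-mass `< 1`
    have hba' : (b : ℝ) + 1 ≤ a := by exact_mod_cast hba
    rw [Finset.Icc_eq_empty_of_lt hba, Finset.sum_empty, zero_sub, norm_neg]
    calc ‖∫ t in T₁..T₂, g t • F t‖ ≤ M₀ * (G T₂ - G T₁) := hbd T₁ T₂ le_rfl hT le_rfl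
      _ ≤ M₀ * 1 := mul_le_mul_of_nonneg_left (by linarith) hM0
      _ ≤ 3 * M₀ + ∫ t in T₁..T₂, ‖F' t‖ := by linarith
  · -- nodes `s i = G⁻¹(a + i)`, `i = 0, …, N`
    obtain ⟨N, hN⟩ : ∃ N : ℕ, b = a + N := ⟨(b - a).toNat, by omega⟩
    set s : ℕ → ℝ := fun i => countingNode G T₁ T₂ (a + i) with hs
    have hlev : ∀ i ≤ N, (((a + i : ℤ)) : ℝ) ∈ Set.Icc (G T₁) (G T₂) := by
      intro i hi
      have h1 : (a : ℝ) ≤ ((a + i : ℤ) : ℝ) := by push_cast; linarith [(Nat.cast_nonneg i : (0 : ℝ) ≤ i)]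
      have h2 : ((a + i : ℤ) : ℝ) ≤ b := by
        have : (i : ℤ) ≤ N := by exact_mod_cast hi
        have : a + (i : ℤ) ≤ b := by omega
        exact_mod_cast this
      exact ⟨ha₁.trans h1, h2.trans hb₁⟩
    have hsI : ∀ i ≤ N, s i ∈ Set.Icc T₁ T₂ := fun i hi => countingNode_mem_Icc hT hGc (hlev i hi)
    have hGs : ∀ i ≤ N, G (s i) = a + i := fun i hi => by
      have h := apply_countingNode hT hGc (hlev i hi); push_cast at h; exact h
    have hstep : ∀ i < N, s i < s (i + 1) := fun i hi =>
      countingNode_lt_countingNode hT hGc hGm (hlev i hi.le) (by exact_mod_cast hlev (i + 1) hi) (by omega)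
    have hs0N : s 0 ≤ s N := by
      rw [← hGm.le_iff_le (hsI 0 (Nat.zero_le _)) (hsI N le_rfl), hGs 0 (Nat.zero_le _), hGs N le_rfl]
      push_cast; linarith [(Nat.cast_nonneg N : (0 : ℝ) ≤ N)]
    -- `G`-mass of a cell is `1`
    have hcellg : ∀ i < N, ∫ t in s i..s (i + 1), g t = 1 := by
      intro i hi
      rw [hGftc _ _ (hsI i hi.le).1 (hstep i hi).le (hsI (i + 1) hi).2, hGs i hi.le, hGs (i + 1) hi]
      push_cast; ring
    -- reindex the sum
    have hsum : ∑ k ∈ Finset.Icc a b, F (countingNode G T₁ T₂ k) = ∑ i ∈ Finset.range (N + 1), F (s i) := by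
      rw [Int.Icc_eq_finset_map, Finset.sum_map, show (b + 1 - a).toNat = N + 1 by omega]
      refine Finset.sum_congr rfl fun i _ => ?_
      simp only [Function.Embedding.trans_apply, Nat.castEmbedding_apply, addLeftEmbedding_apply, hs]
    -- split the integral and the sum
    have hsplit : ∫ t in T₁..T₂, g t • F t
        = (∫ t in T₁..s 0, g t • F t) + (∑ i ∈ Finset.range N, ∫ t in s i..s (i + 1), g t • F t)
          + ∫ t in s N..T₂, g t • F t := by
      rw [sum_integral_adjacent_intervals fun k hk =>
          hgF _ _ (hsI k hk.le) (hsI (k + 1) (Nat.succ_le_of_lt hk)),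
        integral_add_adjacent_intervals (hgF _ _ hT₁I (hsI 0 (Nat.zero_le _)))
          (hgF _ _ (hsI 0 (Nat.zero_le _)) (hsI N le_rfl)),
        integral_add_adjacent_intervals (hgF _ _ hT₁I (hsI N le_rfl)) (hgF _ _ (hsI N le_rfl) hT₂I)]
    rw [hsum, Finset.sum_range_succ, hsplit]
    have hrearr : (∑ i ∈ Finset.range N, F (s i)) + F (s N)
        - ((∫ t in T₁..s 0, g t • F t) + (∑ i ∈ Finset.range N, ∫ t in s i..s (i + 1), g t • F t)
          + ∫ t in s N..T₂, g t • F t)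
        = (∑ i ∈ Finset.range N, (F (s i) - ∫ t in s i..s (i + 1), g t • F t))
          + (F (s N) - (∫ t in T₁..s 0, g t • F t) - ∫ t in s N..T₂, g t • F t) := by
      rw [Finset.sum_sub_distrib]; abel
    rw [hrearr]
    -- the cells
    have hcell : ∀ i ∈ Finset.range N,
        ‖F (s i) - ∫ t in s i..s (i + 1), g t • F t‖ ≤ ∫ t in s i..s (i + 1), ‖F' t‖ := by
      intro i hi
      have hiN : i < N := Finset.mem_range.1 hi
      have h := norm_integral_smul_sub_integral_smul_cell_le (hsI i hiN.le).1 (hstep i hiN).le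
        (hsI (i + 1) hiN).2 hgi hg0 hF hF' hint
      rwa [hcellg i hiN, one_smul, one_mul] at h
    have hcells : ‖∑ i ∈ Finset.range N, (F (s i) - ∫ t in s i..s (i + 1), g t • F t)‖
        ≤ ∫ t in T₁..T₂, ‖F' t‖ := by
      calc ‖∑ i ∈ Finset.range N, (F (s i) - ∫ t in s i..s (i + 1), g t • F t)‖
          ≤ ∑ i ∈ Finset.range N, ‖F (s i) - ∫ t in s i..s (i + 1), g t • F t‖ := norm_sum_le _ _
        _ ≤ ∑ i ∈ Finset.range N, ∫ t in s i..s (i + 1), ‖F' t‖ := Finset.sum_le_sum hcell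
        _ = ∫ t in s 0..s N, ‖F' t‖ :=
            sum_integral_adjacent_intervals fun k hk => hnint' _ _ (hsI k hk.le) (hsI (k + 1) (Nat.succ_le_of_lt hk))
        _ ≤ ∫ t in T₁..T₂, ‖F' t‖ :=
            integral_mono_interval (hsI 0 (Nat.zero_le _)).1 hs0N (hsI N le_rfl).2
              (Eventually.of_forall fun _ => norm_nonneg _) hnint
    -- the last node and the two ragged ends
    have hlast : ‖F (s N)‖ ≤ M₀ := hM _ (hsI N le_rfl)
    have hleft : ‖∫ t in T₁..s 0, g t • F t‖ ≤ M₀ := by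
      refine (hbd T₁ (s 0) le_rfl (hsI 0 (Nat.zero_le _)).1 (hsI 0 (Nat.zero_le _)).2).trans ?_
      rw [hGs 0 (Nat.zero_le _)]
      calc M₀ * ((a : ℝ) + ((0 : ℕ) : ℝ) - G T₁) ≤ M₀ * 1 :=
            mul_le_mul_of_nonneg_left (by push_cast; linarith) hM0
        _ = M₀ := mul_one _
    have hright : ‖∫ t in s N..T₂, g t • F t‖ ≤ M₀ := by
      refine (hbd (s N) T₂ (hsI N le_rfl).1 (hsI N le_rfl).2 le_rfl).trans ?_
      rw [hGs N le_rfl]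
      have hbN : (a : ℝ) + N = b := by rw [hN]; push_cast; ring
      calc M₀ * (G T₂ - ((a : ℝ) + N)) ≤ M₀ * 1 := mul_le_mul_of_nonneg_left (by rw [hbN]; linarith) hM0
        _ = M₀ := mul_one _
    calc ‖(∑ i ∈ Finset.range N, (F (s i) - ∫ t in s i..s (i + 1), g t • F t))
          + (F (s N) - (∫ t in T₁..s 0, g t • F t) - ∫ t in s N..T₂, g t • F t)‖
        ≤ ‖∑ i ∈ Finset.range N, (F (s i) - ∫ t in s i..s (i + 1), g t • F t)‖
          + ‖F (s N) - (∫ t in T₁..s 0, g t • F t) - ∫ t in s N..T₂, g t • F t‖ := norm_add_le _ _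
      _ ≤ (∫ t in T₁..T₂, ‖F' t‖) + (M₀ + M₀ + M₀) := by
          refine add_le_add hcells ?_
          calc ‖F (s N) - (∫ t in T₁..s 0, g t • F t) - ∫ t in s N..T₂, g t • F t‖
              ≤ ‖F (s N) - ∫ t in T₁..s 0, g t • F t‖ + ‖∫ t in s N..T₂, g t • F t‖ := norm_sub_le _ _
            _ ≤ (‖F (s N)‖ + ‖∫ t in T₁..s 0, g t • F t‖) + ‖∫ t in s N..T₂, g t • F t‖ :=
                add_le_add (norm_sub_le _ _) le_rfl
            _ ≤ M₀ + M₀ + M₀ := add_le_add (add_le_add hlast hleft) hright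
      _ = 3 * M₀ + ∫ t in T₁..T₂, ‖F' t‖ := by ring

/-! ### The mollifier-length corollary: `Σ_{n ≤ y} n⁻¹ f(log n / log y)` against `(log y) ∫₀¹ f` -/

/-- `{1, …, N} ⊂ ℕ` cast into `ℤ` is `{1, …, N} ⊂ ℤ`. [folklore] -/
private theorem map_natCast_Icc_one (N : ℕ) :
    (Finset.Icc 1 N).map Nat.castEmbedding = Finset.Icc (1 : ℤ) N := by
  ext x
  simp only [Finset.mem_map, Finset.mem_Icc, Nat.castEmbedding_apply]
  constructor
  · rintro ⟨n, ⟨h1, h2⟩, rfl⟩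
    exact ⟨by exact_mod_cast h1, by exact_mod_cast h2⟩
  · rintro ⟨h1, h2⟩
    exact ⟨x.toNat, ⟨by omega, by omega⟩, Int.toNat_of_nonneg (by omega)⟩

/-- `∫₀¹ L e^{−Lu} du = 1 − e^{−L}`. [folklore] -/
private theorem integral_mul_exp_neg_mul (L : ℝ) :
    ∫ u in (0 : ℝ)..1, L * Real.exp (-(L * u)) = 1 - Real.exp (-L) := by
  have hd : ∀ u ∈ Set.uIcc (0 : ℝ) 1, HasDerivAt (fun u => -Real.exp (-(L * u))) (L * Real.exp (-(L * u))) u := by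
    intro u _
    have h := ((HasDerivAt.const_mul L (hasDerivAt_id' u)).neg).exp.neg
    exact h.congr_deriv (by simp only [Pi.neg_apply]; ring)
  rw [integral_eq_sub_of_hasDerivAt hd ((by fun_prop : Continuous fun u => L * Real.exp (-(L * u))).intervalIntegrable _ _)]
  simp only [mul_one, mul_zero, neg_zero, Real.exp_zero]
  ring

/-- **Dirichlet-polynomial lengths in the logarithmic scale — the mollifier-length Riemann sum.** For `y > 1` and a profile
`f : [0, 1] → E` continuous with a right derivative `f′` at every interior point, `f′` integrable and `‖f‖ ≤ M` on `[0, 1]`: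
`‖Σ_{1 ≤ n ≤ y} n⁻¹ • f(log n / log y) − log y • ∫₀¹ f‖ ≤ 4M + ∫₀¹ ‖f′‖` — Abel's identity for the nodes `u_n = log n/log y` of
the counting function `G(u) = y^u` (density `log y · y^u`) applied to `F(u) = y^{−u} • f(u)` (`‖F‖ ≤ M`,
`∫₀¹‖F′‖ ≤ M(1 − 1/y) + ∫₀¹‖f′‖`); the error is uniform in `y` and explicit in the profile (`H¹` profiles allowed).
[cite: Apostol1976, Thm 4.2 pp. 76–77] -/
theorem norm_sum_inv_smul_logProfile_sub_le {f f' : ℝ → E} {y M : ℝ} (hy : 1 < y)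
    (hf : ContinuousOn f (Set.Icc 0 1)) (hf' : ∀ u ∈ Set.Ioo (0 : ℝ) 1, HasDerivWithinAt f (f' u) (Set.Ioi u) u)
    (hint : IntervalIntegrable f' volume 0 1) (hM : ∀ u ∈ Set.Icc (0 : ℝ) 1, ‖f u‖ ≤ M) :
    ‖∑ n ∈ Finset.Icc 1 ⌊y⌋₊, ((n : ℝ))⁻¹ • f (Real.log n / Real.log y) - Real.log y • ∫ u in (0 : ℝ)..1, f u‖
      ≤ 4 * M + ∫ u in (0 : ℝ)..1, ‖f' u‖ := by
  have hy0 : 0 < y := zero_lt_one.trans hy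
  set L : ℝ := Real.log y with hL
  have hL0 : 0 < L := Real.log_pos hy
  have hM0 : 0 ≤ M := (norm_nonneg _).trans (hM 0 ⟨le_rfl, zero_le_one⟩)
  -- the counting function `G(u) = e^{Lu} = y^u`, density `g = L e^{Lu}`, and `F = e^{−Lu} • f`
  set G : ℝ → ℝ := fun u => Real.exp (L * u) with hG
  set g : ℝ → ℝ := fun u => L * Real.exp (L * u) with hg
  set c : ℝ → ℝ := fun u => Real.exp (-(L * u)) with hc
  set F : ℝ → E := fun u => c u • f u with hF
  set F' : ℝ → E := fun u => c u • f' u + (Real.exp (-(L * u)) * -(L * 1)) • f u with hF'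
  have hGc : ContinuousOn G (Set.Icc 0 1) := (by fun_prop : Continuous G).continuousOn
  have hGm : StrictMonoOn G (Set.Icc 0 1) :=
    (Real.exp_strictMono.comp (strictMono_mul_left_of_pos hL0)).strictMonoOn _
  have hG' : ∀ u ∈ Set.Ioo (0 : ℝ) 1, HasDerivWithinAt G (g u) (Set.Ioi u) u := by
    intro u _
    have h := (HasDerivAt.const_mul L (hasDerivAt_id' u)).exp
    exact (h.congr_deriv (by simp only [hg]; ring)).hasDerivWithinAt
  have hgi : IntervalIntegrable g volume 0 1 := (by fun_prop : Continuous g).intervalIntegrable _ _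
  have hg0 : ∀ u ∈ Set.Icc (0 : ℝ) 1, 0 ≤ g u := fun u _ => mul_nonneg hL0.le (Real.exp_pos _).le
  have hcc : Continuous c := by fun_prop
  have hcd : ∀ u, HasDerivAt c (Real.exp (-(L * u)) * -(L * 1)) u := fun u =>
    ((HasDerivAt.const_mul L (hasDerivAt_id' u)).neg).exp
  have hc1 : ∀ u, 0 ≤ u → c u ≤ 1 := fun u hu => by
    simp only [hc]; rw [Real.exp_le_one_iff]; nlinarith
  have hc0 : ∀ u, 0 < c u := fun u => Real.exp_pos _
  have hFc : ContinuousOn F (Set.Icc 0 1) := hcc.continuousOn.smul hf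
  have hFd : ∀ u ∈ Set.Ioo (0 : ℝ) 1, HasDerivWithinAt F (F' u) (Set.Ioi u) u := fun u hu =>
    (hcd u).hasDerivWithinAt.smul (hf' u hu)
  have hF'i : IntervalIntegrable F' volume 0 1 :=
    (hint.continuousOn_smul hcc.continuousOn).add
      ((by fun_prop : Continuous fun u => Real.exp (-(L * u)) * -(L * 1)).intervalIntegrable _ _
        |>.smul_continuousOn (by rwa [Set.uIcc_of_le zero_le_one]))
  have hFM : ∀ u ∈ Set.Icc (0 : ℝ) 1, ‖F u‖ ≤ M := fun u hu => by
    simp only [hF]; rw [norm_smul, Real.norm_of_nonneg (hc0 u).le]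
    calc c u * ‖f u‖ ≤ 1 * M := mul_le_mul (hc1 u hu.1) (hM u hu) (norm_nonneg _) zero_le_one
      _ = M := one_mul M
  -- the main inequality for these data
  have hmain := norm_sum_countingNodes_sub_integral_smul_le zero_le_one hGc hGm hG' hgi hg0 hFc hFd hF'i hFM
  -- levels: `G 0 = 1`, `G 1 = y`
  have hG0 : G 0 = 1 := by simp [hG]
  have hG1 : G 1 = y := by simp [hG, hL, Real.exp_log hy0]
  rw [hG0, hG1, Int.ceil_one] at hmain
  -- the nodes: `G⁻¹ k = log k / L` and `F(log k / L) = k⁻¹ • f(log k / log y)` for `1 ≤ k ≤ y`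
  have hnode : ∀ k ∈ Finset.Icc (1 : ℤ) ⌊y⌋,
      F (countingNode G 0 1 k) = ((k : ℝ))⁻¹ • f (Real.log k / Real.log y) := by
    intro k hk
    rw [Finset.mem_Icc] at hk
    have hk1 : (1 : ℝ) ≤ k := by exact_mod_cast hk.1
    have hky : (k : ℝ) ≤ y := (Int.cast_le.2 hk.2).trans (Int.floor_le y)
    have hk0 : (0 : ℝ) < k := zero_lt_one.trans_le hk1
    have hlogk : 0 ≤ Real.log k := Real.log_nonneg hk1
    have hlogk' : Real.log k ≤ L := Real.log_le_log hk0 hky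
    have htI : Real.log k / L ∈ Set.Icc (0 : ℝ) 1 :=
      ⟨div_nonneg hlogk hL0.le, by rw [div_le_one hL0]; exact hlogk'⟩
    have hGt : G (Real.log k / L) = k := by
      simp only [hG]; rw [mul_div_cancel₀ _ hL0.ne', Real.exp_log hk0]
    rw [countingNode_eq_of_apply_eq hGm.injOn htI hGt]
    simp only [hF, hc]
    rw [mul_div_cancel₀ _ hL0.ne', Real.exp_neg, Real.exp_log hk0]
  have hsum : ∑ k ∈ Finset.Icc (1 : ℤ) ⌊y⌋, F (countingNode G 0 1 k)
      = ∑ n ∈ Finset.Icc 1 ⌊y⌋₊, ((n : ℝ))⁻¹ • f (Real.log n / Real.log y) := by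
    rw [Finset.sum_congr rfl hnode, ← Int.natCast_floor_eq_floor hy0.le, ← map_natCast_Icc_one, Finset.sum_map]
    simp
  -- the integral: `g • F = L • f`
  have hint_eq : ∫ u in (0 : ℝ)..1, g u • F u = Real.log y • ∫ u in (0 : ℝ)..1, f u := by
    rw [← intervalIntegral.integral_smul]
    refine intervalIntegral.integral_congr fun u _ => ?_
    simp only [hg, hF, hc, smul_smul]
    congr 1
    rw [mul_assoc, ← Real.exp_add]; simp [hL]
  rw [hsum, hint_eq] at hmain
  -- the variation of `F`: `∫₀¹ ‖F′‖ ≤ M(1 − e^{−L}) + ∫₀¹ ‖f′‖ ≤ M + ∫₀¹ ‖f′‖`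
  have hvar : ∫ u in (0 : ℝ)..1, ‖F' u‖ ≤ M + ∫ u in (0 : ℝ)..1, ‖f' u‖ := by
    have hpt : ∀ u ∈ Set.Icc (0 : ℝ) 1, ‖F' u‖ ≤ M * (L * Real.exp (-(L * u))) + ‖f' u‖ := by
      intro u hu
      simp only [hF']
      refine (norm_add_le _ _).trans ?_
      rw [add_comm, norm_smul, norm_smul, Real.norm_of_nonneg (hc0 u).le]
      refine add_le_add ?_ ?_
      · rw [Real.norm_eq_abs, show Real.exp (-(L * u)) * -(L * 1) = -(L * Real.exp (-(L * u))) by ring, abs_neg,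
          abs_of_nonneg (mul_nonneg hL0.le (Real.exp_pos _).le), mul_comm]
        exact mul_le_mul_of_nonneg_right (hM u hu) (mul_nonneg hL0.le (Real.exp_pos _).le)
      · calc c u * ‖f' u‖ ≤ 1 * ‖f' u‖ := mul_le_mul_of_nonneg_right (hc1 u hu.1) (norm_nonneg _)
          _ = ‖f' u‖ := one_mul _
    have hgi2 : IntervalIntegrable (fun u => M * (L * Real.exp (-(L * u))) + ‖f' u‖) volume 0 1 :=
      ((by fun_prop : Continuous fun u => M * (L * Real.exp (-(L * u)))).intervalIntegrable _ _).add hint.norm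
    calc ∫ u in (0 : ℝ)..1, ‖F' u‖ ≤ ∫ u in (0 : ℝ)..1, (M * (L * Real.exp (-(L * u))) + ‖f' u‖) :=
          intervalIntegral.integral_mono_on zero_le_one hF'i.norm hgi2 hpt
      _ = M * (1 - Real.exp (-L)) + ∫ u in (0 : ℝ)..1, ‖f' u‖ := by
          rw [intervalIntegral.integral_add ((by fun_prop : Continuous fun u =>
              M * (L * Real.exp (-(L * u)))).intervalIntegrable _ _) hint.norm,
            intervalIntegral.integral_const_mul, integral_mul_exp_neg_mul]
      _ ≤ M + ∫ u in (0 : ℝ)..1, ‖f' u‖ := by nlinarith [Real.exp_pos (-L)]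
  linarith

/-! ### Limit forms of the mollifier-length sum: `(log y)⁻¹ Σ_{n ≤ y} n⁻¹ f(log n/log y) → ∫₀¹ f` -/

/-- **Fixed profile, `y → ∞`**: `(log y)⁻¹ • Σ_{1 ≤ n ≤ y} n⁻¹ • f(log n/log y) → ∫₀¹ f` for every `f` continuous on `[0, 1]`
with an integrable right derivative on `(0, 1)` (rate `(4 sup‖f‖ + ∫‖f′‖)/log y` from `norm_sum_inv_smul_logProfile_sub_le`).
[cite: Apostol1976, Thm 4.2 pp. 76–77] -/
theorem tendsto_inv_log_smul_sum_inv_smul_logProfile {f f' : ℝ → E} (hf : ContinuousOn f (Set.Icc 0 1))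
    (hf' : ∀ u ∈ Set.Ioo (0 : ℝ) 1, HasDerivWithinAt f (f' u) (Set.Ioi u) u)
    (hint : IntervalIntegrable f' volume 0 1) :
    Tendsto (fun y : ℝ => (Real.log y)⁻¹ • ∑ n ∈ Finset.Icc 1 ⌊y⌋₊, ((n : ℝ))⁻¹ • f (Real.log n / Real.log y))
      atTop (𝓝 (∫ u in (0 : ℝ)..1, f u)) := by
  obtain ⟨M, hM⟩ := isCompact_Icc.exists_bound_of_continuousOn hf
  set C : ℝ := 4 * M + ∫ u in (0 : ℝ)..1, ‖f' u‖ with hC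
  have hlog : Tendsto (fun y : ℝ => (Real.log y)⁻¹ * C) atTop (𝓝 0) := by
    simpa using (Real.tendsto_log_atTop.inv_tendsto_atTop).mul_const C
  rw [tendsto_iff_norm_sub_tendsto_zero]
  refine squeeze_zero' (Eventually.of_forall fun _ => norm_nonneg _) ?_ hlog
  filter_upwards [eventually_gt_atTop (1 : ℝ)] with y hy
  have hL : 0 < Real.log y := Real.log_pos hy
  have h := norm_sum_inv_smul_logProfile_sub_le hy hf hf' hint hM
  have hrw : (Real.log y)⁻¹ • ∑ n ∈ Finset.Icc 1 ⌊y⌋₊, ((n : ℝ))⁻¹ • f (Real.log n / Real.log y)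
        - ∫ u in (0 : ℝ)..1, f u
      = (Real.log y)⁻¹ • (∑ n ∈ Finset.Icc 1 ⌊y⌋₊, ((n : ℝ))⁻¹ • f (Real.log n / Real.log y)
        - Real.log y • ∫ u in (0 : ℝ)..1, f u) := by
    rw [smul_sub, smul_smul, inv_mul_cancel₀ hL.ne', one_smul]
  rw [hrw, norm_smul, norm_inv, Real.norm_of_nonneg hL.le]
  exact mul_le_mul_of_nonneg_left h (inv_nonneg.2 hL.le)

/-- **Stage-dependent profiles with uniform bounds, `y_n → ∞`**: if `‖f_n‖ ≤ M` on `[0, 1]` and `∫₀¹ ‖f_n′‖ ≤ V` for all `n`,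
then `(log y_n)⁻¹ • Σ_{1 ≤ m ≤ y_n} m⁻¹ • f_n(log m/log y_n) − ∫₀¹ f_n → 0` — the uniformity is free from the explicit
inequality. [cite: Apostol1976, Thm 4.2 pp. 76–77] -/
theorem tendsto_inv_log_smul_sum_inv_smul_logProfile_sub {f f' : ℕ → ℝ → E} {M V : ℝ}
    (hf : ∀ n, ContinuousOn (f n) (Set.Icc 0 1))
    (hf' : ∀ n, ∀ u ∈ Set.Ioo (0 : ℝ) 1, HasDerivWithinAt (f n) (f' n u) (Set.Ioi u) u)
    (hint : ∀ n, IntervalIntegrable (f' n) volume 0 1) (hM : ∀ n, ∀ u ∈ Set.Icc (0 : ℝ) 1, ‖f n u‖ ≤ M)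
    (hV : ∀ n, ∫ u in (0 : ℝ)..1, ‖f' n u‖ ≤ V) {y : ℕ → ℝ} (hy : Tendsto y atTop atTop) :
    Tendsto (fun n => (Real.log (y n))⁻¹ • ∑ m ∈ Finset.Icc 1 ⌊y n⌋₊, ((m : ℝ))⁻¹ • f n (Real.log m / Real.log (y n))
      - ∫ u in (0 : ℝ)..1, f n u) atTop (𝓝 0) := by
  have hlog : Tendsto (fun n => (Real.log (y n))⁻¹ * (4 * M + V)) atTop (𝓝 0) := by
    simpa using ((Real.tendsto_log_atTop.comp hy).inv_tendsto_atTop).mul_const (4 * M + V)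
  rw [tendsto_zero_iff_norm_tendsto_zero]
  refine squeeze_zero' (Eventually.of_forall fun _ => norm_nonneg _) ?_ hlog
  filter_upwards [hy.eventually_gt_atTop (1 : ℝ)] with n hn
  have hL : 0 < Real.log (y n) := Real.log_pos hn
  have h := norm_sum_inv_smul_logProfile_sub_le hn (hf n) (hf' n) (hint n) (hM n)
  have hrw : (Real.log (y n))⁻¹ • ∑ m ∈ Finset.Icc 1 ⌊y n⌋₊, ((m : ℝ))⁻¹ • f n (Real.log m / Real.log (y n))
        - ∫ u in (0 : ℝ)..1, f n u
      = (Real.log (y n))⁻¹ • (∑ m ∈ Finset.Icc 1 ⌊y n⌋₊, ((m : ℝ))⁻¹ • f n (Real.log m / Real.log (y n))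
        - Real.log (y n) • ∫ u in (0 : ℝ)..1, f n u) := by
    rw [smul_sub, smul_smul, inv_mul_cancel₀ hL.ne', one_smul]
  rw [hrw, norm_smul, norm_inv, Real.norm_of_nonneg hL.le]
  refine (mul_le_mul_of_nonneg_left h (inv_nonneg.2 hL.le)).trans ?_
  exact mul_le_mul_of_nonneg_left (by linarith [hV n]) (inv_nonneg.2 hL.le)

/-! ### Two scales: length `x`, logarithmic scale `L` (`Σ_{n ≤ x} n⁻¹ f(log n / L)` against `L ∫₀^{log x/L} f`) -/

/-- `∫₀^U L e^{−Lu} du = 1 − e^{−LU}`. [folklore] -/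
private theorem integral_mul_exp_neg_mul' (L U : ℝ) :
    ∫ u in (0 : ℝ)..U, L * Real.exp (-(L * u)) = 1 - Real.exp (-(L * U)) := by
  have hd : ∀ u ∈ Set.uIcc (0 : ℝ) U, HasDerivAt (fun u => -Real.exp (-(L * u))) (L * Real.exp (-(L * u))) u := by
    intro u _
    have h := ((HasDerivAt.const_mul L (hasDerivAt_id' u)).neg).exp.neg
    exact h.congr_deriv (by simp only [Pi.neg_apply]; ring)
  rw [integral_eq_sub_of_hasDerivAt hd ((by fun_prop : Continuous fun u => L * Real.exp (-(L * u))).intervalIntegrable _ _)]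
  simp only [mul_zero, neg_zero, Real.exp_zero]
  ring

/-- **Length `x`, scale `L` — the mixed-scale mollifier sum.** For `L > 0`, `x ≥ 1`, `U := log x / L`, and a profile `f`
continuous on `[0, U]` with a right derivative `f′` at every interior point, `f′` integrable and `‖f‖ ≤ M` on `[0, U]`:
`‖Σ_{1 ≤ n ≤ x} n⁻¹ • f(log n / L) − L • ∫₀^U f‖ ≤ 4M + ∫₀^U ‖f′‖` (the case `L = log y`, `x = y`, `U = 1` is
`norm_sum_inv_smul_logProfile_sub_le`; a piece of length `x = y^θ` read in the scale `log y` has `U = θ`). Abel's identity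
for the nodes `log n / L` of `G(u) = e^{Lu}` applied to `F = e^{−Lu} • f`. [cite: Apostol1976, Thm 4.2 pp. 76–77] -/
theorem norm_sum_inv_smul_logScale_sub_le {f f' : ℝ → E} {L x M : ℝ} (hL0 : 0 < L) (hx : 1 ≤ x)
    (hf : ContinuousOn f (Set.Icc 0 (Real.log x / L)))
    (hf' : ∀ u ∈ Set.Ioo (0 : ℝ) (Real.log x / L), HasDerivWithinAt f (f' u) (Set.Ioi u) u)
    (hint : IntervalIntegrable f' volume 0 (Real.log x / L))
    (hM : ∀ u ∈ Set.Icc (0 : ℝ) (Real.log x / L), ‖f u‖ ≤ M) :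
    ‖∑ n ∈ Finset.Icc 1 ⌊x⌋₊, ((n : ℝ))⁻¹ • f (Real.log n / L) - L • ∫ u in (0 : ℝ)..(Real.log x / L), f u‖
      ≤ 4 * M + ∫ u in (0 : ℝ)..(Real.log x / L), ‖f' u‖ := by
  have hx0 : 0 < x := zero_lt_one.trans_le hx
  set U : ℝ := Real.log x / L with hU
  have hU0 : 0 ≤ U := div_nonneg (Real.log_nonneg hx) hL0.le
  have hM0 : 0 ≤ M := (norm_nonneg _).trans (hM 0 ⟨le_rfl, hU0⟩)
  -- the counting function `G(u) = e^{Lu}`, density `g = L e^{Lu}`, and `F = e^{−Lu} • f`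
  set G : ℝ → ℝ := fun u => Real.exp (L * u) with hG
  set g : ℝ → ℝ := fun u => L * Real.exp (L * u) with hg
  set c : ℝ → ℝ := fun u => Real.exp (-(L * u)) with hc
  set F : ℝ → E := fun u => c u • f u with hF
  set F' : ℝ → E := fun u => c u • f' u + (Real.exp (-(L * u)) * -(L * 1)) • f u with hF'
  have hGc : ContinuousOn G (Set.Icc 0 U) := (by fun_prop : Continuous G).continuousOn
  have hGm : StrictMonoOn G (Set.Icc 0 U) :=
    (Real.exp_strictMono.comp (strictMono_mul_left_of_pos hL0)).strictMonoOn _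
  have hG' : ∀ u ∈ Set.Ioo (0 : ℝ) U, HasDerivWithinAt G (g u) (Set.Ioi u) u := by
    intro u _
    have h := (HasDerivAt.const_mul L (hasDerivAt_id' u)).exp
    exact (h.congr_deriv (by simp only [hg]; ring)).hasDerivWithinAt
  have hgi : IntervalIntegrable g volume 0 U := (by fun_prop : Continuous g).intervalIntegrable _ _
  have hg0 : ∀ u ∈ Set.Icc (0 : ℝ) U, 0 ≤ g u := fun u _ => mul_nonneg hL0.le (Real.exp_pos _).le
  have hcc : Continuous c := by fun_prop
  have hcd : ∀ u, HasDerivAt c (Real.exp (-(L * u)) * -(L * 1)) u := fun u =>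
    ((HasDerivAt.const_mul L (hasDerivAt_id' u)).neg).exp
  have hc1 : ∀ u, 0 ≤ u → c u ≤ 1 := fun u hu => by
    simp only [hc]; rw [Real.exp_le_one_iff]; nlinarith
  have hc0 : ∀ u, 0 < c u := fun u => Real.exp_pos _
  have hFc : ContinuousOn F (Set.Icc 0 U) := hcc.continuousOn.smul hf
  have hFd : ∀ u ∈ Set.Ioo (0 : ℝ) U, HasDerivWithinAt F (F' u) (Set.Ioi u) u := fun u hu =>
    (hcd u).hasDerivWithinAt.smul (hf' u hu)
  have hF'i : IntervalIntegrable F' volume 0 U :=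
    (hint.continuousOn_smul hcc.continuousOn).add
      ((by fun_prop : Continuous fun u => Real.exp (-(L * u)) * -(L * 1)).intervalIntegrable _ _
        |>.smul_continuousOn (by rwa [Set.uIcc_of_le hU0]))
  have hFM : ∀ u ∈ Set.Icc (0 : ℝ) U, ‖F u‖ ≤ M := fun u hu => by
    simp only [hF]; rw [norm_smul, Real.norm_of_nonneg (hc0 u).le]
    calc c u * ‖f u‖ ≤ 1 * M := mul_le_mul (hc1 u hu.1) (hM u hu) (norm_nonneg _) zero_le_one
      _ = M := one_mul M
  -- the main inequality for these data
  have hmain := norm_sum_countingNodes_sub_integral_smul_le hU0 hGc hGm hG' hgi hg0 hFc hFd hF'i hFM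
  -- levels: `G 0 = 1`, `G U = x`
  have hG0 : G 0 = 1 := by simp [hG]
  have hGU : G U = x := by
    simp only [hG, hU]; rw [mul_div_cancel₀ _ hL0.ne', Real.exp_log hx0]
  rw [hG0, hGU, Int.ceil_one] at hmain
  -- the nodes: `G⁻¹ k = log k / L` and `F(log k / L) = k⁻¹ • f(log k / L)` for `1 ≤ k ≤ x`
  have hnode : ∀ k ∈ Finset.Icc (1 : ℤ) ⌊x⌋,
      F (countingNode G 0 U k) = ((k : ℝ))⁻¹ • f (Real.log k / L) := by
    intro k hk
    rw [Finset.mem_Icc] at hk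
    have hk1 : (1 : ℝ) ≤ k := by exact_mod_cast hk.1
    have hkx : (k : ℝ) ≤ x := (Int.cast_le.2 hk.2).trans (Int.floor_le x)
    have hk0 : (0 : ℝ) < k := zero_lt_one.trans_le hk1
    have hlogk : 0 ≤ Real.log k := Real.log_nonneg hk1
    have hlogk' : Real.log k ≤ Real.log x := Real.log_le_log hk0 hkx
    have htI : Real.log k / L ∈ Set.Icc (0 : ℝ) U :=
      ⟨div_nonneg hlogk hL0.le, div_le_div_of_nonneg_right hlogk' hL0.le⟩
    have hGt : G (Real.log k / L) = k := by
      simp only [hG]; rw [mul_div_cancel₀ _ hL0.ne', Real.exp_log hk0]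
    rw [countingNode_eq_of_apply_eq hGm.injOn htI hGt]
    simp only [hF, hc]
    rw [mul_div_cancel₀ _ hL0.ne', Real.exp_neg, Real.exp_log hk0]
  have hsum : ∑ k ∈ Finset.Icc (1 : ℤ) ⌊x⌋, F (countingNode G 0 U k)
      = ∑ n ∈ Finset.Icc 1 ⌊x⌋₊, ((n : ℝ))⁻¹ • f (Real.log n / L) := by
    rw [Finset.sum_congr rfl hnode, ← Int.natCast_floor_eq_floor hx0.le, ← map_natCast_Icc_one, Finset.sum_map]
    simp
  -- the integral: `g • F = L • f`
  have hint_eq : ∫ u in (0 : ℝ)..U, g u • F u = L • ∫ u in (0 : ℝ)..U, f u := by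
    rw [← intervalIntegral.integral_smul]
    refine intervalIntegral.integral_congr fun u _ => ?_
    simp only [hg, hF, hc, smul_smul]
    congr 1
    rw [mul_assoc, ← Real.exp_add]; simp
  rw [hsum, hint_eq] at hmain
  -- the variation of `F`: `∫₀^U ‖F′‖ ≤ M(1 − e^{−LU}) + ∫₀^U ‖f′‖ ≤ M + ∫₀^U ‖f′‖`
  have hvar : ∫ u in (0 : ℝ)..U, ‖F' u‖ ≤ M + ∫ u in (0 : ℝ)..U, ‖f' u‖ := by
    have hpt : ∀ u ∈ Set.Icc (0 : ℝ) U, ‖F' u‖ ≤ M * (L * Real.exp (-(L * u))) + ‖f' u‖ := by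
      intro u hu
      simp only [hF']
      refine (norm_add_le _ _).trans ?_
      rw [add_comm, norm_smul, norm_smul, Real.norm_of_nonneg (hc0 u).le]
      refine add_le_add ?_ ?_
      · rw [Real.norm_eq_abs, show Real.exp (-(L * u)) * -(L * 1) = -(L * Real.exp (-(L * u))) by ring, abs_neg,
          abs_of_nonneg (mul_nonneg hL0.le (Real.exp_pos _).le), mul_comm]
        exact mul_le_mul_of_nonneg_right (hM u hu) (mul_nonneg hL0.le (Real.exp_pos _).le)
      · calc c u * ‖f' u‖ ≤ 1 * ‖f' u‖ := mul_le_mul_of_nonneg_right (hc1 u hu.1) (norm_nonneg _)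
          _ = ‖f' u‖ := one_mul _
    have hgi2 : IntervalIntegrable (fun u => M * (L * Real.exp (-(L * u))) + ‖f' u‖) volume 0 U :=
      ((by fun_prop : Continuous fun u => M * (L * Real.exp (-(L * u)))).intervalIntegrable _ _).add hint.norm
    calc ∫ u in (0 : ℝ)..U, ‖F' u‖ ≤ ∫ u in (0 : ℝ)..U, (M * (L * Real.exp (-(L * u))) + ‖f' u‖) :=
          intervalIntegral.integral_mono_on hU0 hF'i.norm hgi2 hpt
      _ = M * (1 - Real.exp (-(L * U))) + ∫ u in (0 : ℝ)..U, ‖f' u‖ := by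
          rw [intervalIntegral.integral_add ((by fun_prop : Continuous fun u =>
              M * (L * Real.exp (-(L * u)))).intervalIntegrable _ _) hint.norm,
            intervalIntegral.integral_const_mul, integral_mul_exp_neg_mul']
      _ ≤ M + ∫ u in (0 : ℝ)..U, ‖f' u‖ := by nlinarith [Real.exp_pos (-(L * U))]
  linarith

end Literature.Analysis.Quadrature
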